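import Summits.ResolutionOfSingularities.ResolutionOfSingularities.Theorems.PurelyInseparableDim4PureLeafUnitOddPair
import HarnessLib
import HarnessLib.Audit.Tags

/-!
# Purely inseparable fourfolds — UNIT LEAVES WITH `a₀ = 3`: the order-1 reservoir shape `(1+x₁)^{m−1}(x₀ + x₀x₁ + x₀²x₁)·S²` and its grind transitions (steps)
# (cell res-dim4-pi; brick (δ) «unit leaves x^a(1+x_j)», UNIFORM family «a₀ = 3, one odd partner, even rest») [OURS · counted 0 · a theorem about OUR coordinate-centre frame v4, not about resolution]

Width seat `res-dim4-p-10` (g5).  Sequel of `…PureLeafUnitOddPair` (`a₀ = 1`).  For `a₀ = 3` player A grinds `{x₀}` FIRST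
(`x₀³ → x₀`); B's reply may meanwhile dress `x₁` (`x₁^m ↔ (1+x₁)^m`), which presents — after the cleaning — the ORDER-1 shape
`G̃_m·S² := x₀(1+x₁)^m·S² + x₀²x₁(1+x₁)^{m−1}·S² = (1+x₁)^{m−1}(x₀ + x₀x₁ + x₀²x₁)·S²` (legal only while the dress `S²` is armed,
i.e. has an `x`-part).  THIS FILE: the generic cleaning lemma `clean_even_oddAt` (an all-even-`a` product with exactly one odd
`e_i` cleans to `N(a+δ_i, e−δ_i)`), the product identities, and the GRIND TRANSITIONS `step_F_grind2_G` / `step_F_grind3_G`: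
at `G̃_m·S²` with `g_i ≥ 2` every reply in the chart of `{x_i}` presents `G̃_m·S′²` (iff `b₁ = 0`) or the `a₀ = 1` leaf shape
`A_m·S′² = x₀x₁^m(1+x₀)·S′²` (iff `b₁ = 1`), `S′` the dress with `g_i − 2` and the other dress variable swapped at will; and
`step_F_grind0_B`: at `B_m·S² := x₀³x₁^m(1+x₀)·S²` every reply in the chart of `{x₀}` presents `A_m·S′²` or `G̃_m·S′²`.

Riders: `𝔽₂`-rational replies; the PLAIN coordinate game of OUR frame v4 (`StateWins 2`), not MODE 1h, not CJS; nothing here proves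
F4-C(2,2), `Terminates1h 2 2` or resolution of singularities in dimension ≥ 4 / characteristic `p`; counted 0; AI kernel work, weaker
than expert review. bears_on: LADDER-RESOLUTION:D157-DOOR2 (res-dim4-pi · brick (δ) · unit-leaf row, uniform theorem).
Supports stmt-ResolutionOfSingularities-16155 (helper).
-/

set_option linter.dupNamespace false

open MvPolynomial Finset

open scoped BigOperators

noncomputable section

namespace Summit.ResolutionOfSingularities.ResolutionOfSingularities.Theorems.PIDim4

namespace PureLeafNF

open Literature.AlgebraicGeometry.Resolution
open Literature.AlgebraicGeometry.Resolution.Hauser2010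
open CentreBlowup PthPowerFactor

/-! ## 1. Generic cleaning: all `a` even, exactly one odd `e_i` -/

/-- **Cleaning an all-even-`a` product with exactly one odd dress exponent `e_i`:** `N(a,e)` cleans to `N(a+δ_i, e−δ_i)`
(`(1+x_i)^{e_i} = (1+x_i)^{e_i−1} + x_i(1+x_i)^{e_i−1}`, the first summand is a square). [folklore] -/
theorem clean_even_oddAt (a e : Fin 4 → ℕ) (i : Fin 4) (ha : ∀ l, a l % 2 = 0) (he : ∀ l, l ≠ i → e l % 2 = 0)
    (hei : e i % 2 = 1) :
    deletePthPowers 2 (∏ l, X l ^ a l * (1 + X l) ^ e l : MvPolynomial (Fin 4) (ZMod 2)) =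
      ∏ l, X l ^ Function.update a i (a i + 1) l * (1 + X l) ^ Function.update e i (e i - 1) l := by
  have hE : e = Function.update (Function.update e i (e i - 1)) i (Function.update e i (e i - 1) i + 1) := by
    funext l
    by_cases hl : l = i
    · subst hl; rw [Function.update_self, Function.update_self]; omega
    · rw [Function.update_of_ne hl, Function.update_of_ne hl]
  conv_lhs => rw [hE]
  rw [prod_update_e_succ, deletePthPowers_add,
    deletePthPowers_prod_of_forall_even _ _ ha (fun l => by
      by_cases hl : l = i
      · subst hl; rw [Function.update_self]; omega
      · rw [Function.update_of_ne hl]; exact he l hl), zero_add,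
    deletePthPowers_prod_of_purelyOdd _ _ (l := i) (by rw [Function.update_self]; have := ha i; omega)
      (by rw [Function.update_self]; omega)]

/-! ## 2. Product identities of the `a₀ = 3` class (parameters `m` odd — written `n + 1` with `n` even where convenient — and an even dress `p q r s`) -/

/-- `A_m·S² = x₀x₁^m·S² + x₀²x₁^m·S²`. [folklore] -/
theorem A_eq_add (m p q r s : ℕ) :
    (∏ l, X l ^ (![1, m, p, q] : Fin 4 → ℕ) l * (1 + X l) ^ (![1, 0, r, s] : Fin 4 → ℕ) l : MvPolynomial (Fin 4) (ZMod 2)) = (∏ l, X l ^ (![1, m, p, q] : Fin 4 → ℕ) l * (1 + X l) ^ (![0, 0, r, s] : Fin 4 → ℕ) l : MvPolynomial (Fin 4) (ZMod 2)) + (∏ l, X l ^ (![2, m, p, q] : Fin 4 → ℕ) l * (1 + X l) ^ (![0, 0, r, s] : Fin 4 → ℕ) l : MvPolynomial (Fin 4) (ZMod 2)) := by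
  have hI := prod_update_e_succ (![1, m, p, q] : Fin 4 → ℕ) (![0, 0, r, s] : Fin 4 → ℕ) 0
  have h1 : Function.update (![0, 0, r, s] : Fin 4 → ℕ) 0 ((![0, 0, r, s] : Fin 4 → ℕ) 0 + 1) = (![1, 0, r, s] : Fin 4 → ℕ) := by
    funext l; fin_cases l <;> simp
  have h2 : Function.update (![1, m, p, q] : Fin 4 → ℕ) 0 ((![1, m, p, q] : Fin 4 → ℕ) 0 + 1) = (![2, m, p, q] : Fin 4 → ℕ) := by
    funext l; fin_cases l <;> simp
  rw [h1, h2] at hI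
  exact hI

/-- `x₀(1+x₁)^{n+1}·S² = x₀(1+x₁)^n·S² + x₀x₁(1+x₁)^n·S²`. [folklore] -/
theorem G1_eq_add (n p q r s : ℕ) :
    (∏ l, X l ^ (![1, 0, p, q] : Fin 4 → ℕ) l * (1 + X l) ^ (![0, (n + 1), r, s] : Fin 4 → ℕ) l : MvPolynomial (Fin 4) (ZMod 2)) = (∏ l, X l ^ (![1, 0, p, q] : Fin 4 → ℕ) l * (1 + X l) ^ (![0, n, r, s] : Fin 4 → ℕ) l : MvPolynomial (Fin 4) (ZMod 2)) + (∏ l, X l ^ (![1, 1, p, q] : Fin 4 → ℕ) l * (1 + X l) ^ (![0, n, r, s] : Fin 4 → ℕ) l : MvPolynomial (Fin 4) (ZMod 2)) := by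
  have hI := prod_update_e_succ (![1, 0, p, q] : Fin 4 → ℕ) (![0, n, r, s] : Fin 4 → ℕ) 1
  have h1 : Function.update (![0, n, r, s] : Fin 4 → ℕ) 1 ((![0, n, r, s] : Fin 4 → ℕ) 1 + 1) = (![0, (n + 1), r, s] : Fin 4 → ℕ) := by
    funext l; fin_cases l <;> simp
  have h2 : Function.update (![1, 0, p, q] : Fin 4 → ℕ) 1 ((![1, 0, p, q] : Fin 4 → ℕ) 1 + 1) = (![1, 1, p, q] : Fin 4 → ℕ) := by
    funext l; fin_cases l <;> simp
  rw [h1, h2] at hI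
  exact hI

/-- `(1+x₀)²x₁(1+x₁)^n·S² = x₁(1+x₁)^n·S² + x₀²x₁(1+x₁)^n·S²`. [folklore] -/
theorem split_dsq0_n (n p q r s : ℕ) :
    (∏ l, X l ^ (![0, 1, p, q] : Fin 4 → ℕ) l * (1 + X l) ^ (![2, n, r, s] : Fin 4 → ℕ) l : MvPolynomial (Fin 4) (ZMod 2)) = (∏ l, X l ^ (![0, 1, p, q] : Fin 4 → ℕ) l * (1 + X l) ^ (![0, n, r, s] : Fin 4 → ℕ) l : MvPolynomial (Fin 4) (ZMod 2)) + (∏ l, X l ^ (![2, 1, p, q] : Fin 4 → ℕ) l * (1 + X l) ^ (![0, n, r, s] : Fin 4 → ℕ) l : MvPolynomial (Fin 4) (ZMod 2)) := by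
  have hI := prod_update_e_add_two (![0, 1, p, q] : Fin 4 → ℕ) (![0, n, r, s] : Fin 4 → ℕ) 0
  have h1 : Function.update (![0, n, r, s] : Fin 4 → ℕ) 0 ((![0, n, r, s] : Fin 4 → ℕ) 0 + 2) = (![2, n, r, s] : Fin 4 → ℕ) := by
    funext l; fin_cases l <;> simp
  have h2 : Function.update (![0, 1, p, q] : Fin 4 → ℕ) 0 ((![0, 1, p, q] : Fin 4 → ℕ) 0 + 2) = (![2, 1, p, q] : Fin 4 → ℕ) := by
    funext l; fin_cases l <;> simp
  rw [h1, h2] at hI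
  exact hI

/-- `(1+x₀)²x₁^m·S² = x₁^m·S² + x₀²x₁^m·S²`. [folklore] -/
theorem split_dsq0_m (m p q r s : ℕ) :
    (∏ l, X l ^ (![0, m, p, q] : Fin 4 → ℕ) l * (1 + X l) ^ (![2, 0, r, s] : Fin 4 → ℕ) l : MvPolynomial (Fin 4) (ZMod 2)) = (∏ l, X l ^ (![0, m, p, q] : Fin 4 → ℕ) l * (1 + X l) ^ (![0, 0, r, s] : Fin 4 → ℕ) l : MvPolynomial (Fin 4) (ZMod 2)) + (∏ l, X l ^ (![2, m, p, q] : Fin 4 → ℕ) l * (1 + X l) ^ (![0, 0, r, s] : Fin 4 → ℕ) l : MvPolynomial (Fin 4) (ZMod 2)) := by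
  have hI := prod_update_e_add_two (![0, m, p, q] : Fin 4 → ℕ) (![0, 0, r, s] : Fin 4 → ℕ) 0
  have h1 : Function.update (![0, 0, r, s] : Fin 4 → ℕ) 0 ((![0, 0, r, s] : Fin 4 → ℕ) 0 + 2) = (![2, 0, r, s] : Fin 4 → ℕ) := by
    funext l; fin_cases l <;> simp
  have h2 : Function.update (![0, m, p, q] : Fin 4 → ℕ) 0 ((![0, m, p, q] : Fin 4 → ℕ) 0 + 2) = (![2, m, p, q] : Fin 4 → ℕ) := by
    funext l; fin_cases l <;> simp
  rw [h1, h2] at hI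
  exact hI

/-- `(1+x₀)x₁^m·S² = x₁^m·S² + x₀x₁^m·S²`. [folklore] -/
theorem split_d0_m (m p q r s : ℕ) :
    (∏ l, X l ^ (![0, m, p, q] : Fin 4 → ℕ) l * (1 + X l) ^ (![1, 0, r, s] : Fin 4 → ℕ) l : MvPolynomial (Fin 4) (ZMod 2)) = (∏ l, X l ^ (![0, m, p, q] : Fin 4 → ℕ) l * (1 + X l) ^ (![0, 0, r, s] : Fin 4 → ℕ) l : MvPolynomial (Fin 4) (ZMod 2)) + (∏ l, X l ^ (![1, m, p, q] : Fin 4 → ℕ) l * (1 + X l) ^ (![0, 0, r, s] : Fin 4 → ℕ) l : MvPolynomial (Fin 4) (ZMod 2)) := by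
  have hI := prod_update_e_succ (![0, m, p, q] : Fin 4 → ℕ) (![0, 0, r, s] : Fin 4 → ℕ) 0
  have h1 : Function.update (![0, 0, r, s] : Fin 4 → ℕ) 0 ((![0, 0, r, s] : Fin 4 → ℕ) 0 + 1) = (![1, 0, r, s] : Fin 4 → ℕ) := by
    funext l; fin_cases l <;> simp
  have h2 : Function.update (![0, m, p, q] : Fin 4 → ℕ) 0 ((![0, m, p, q] : Fin 4 → ℕ) 0 + 1) = (![1, m, p, q] : Fin 4 → ℕ) := by
    funext l; fin_cases l <;> simp
  rw [h1, h2] at hI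
  exact hI

/-- `(1+x₀)(1+x₁)^{n+1}·S² = (1+x₁)^{n+1}·S² + x₀(1+x₁)^{n+1}·S²`. [folklore] -/
theorem split_d0_G (n p q r s : ℕ) :
    (∏ l, X l ^ (![0, 0, p, q] : Fin 4 → ℕ) l * (1 + X l) ^ (![1, (n + 1), r, s] : Fin 4 → ℕ) l : MvPolynomial (Fin 4) (ZMod 2)) = (∏ l, X l ^ (![0, 0, p, q] : Fin 4 → ℕ) l * (1 + X l) ^ (![0, (n + 1), r, s] : Fin 4 → ℕ) l : MvPolynomial (Fin 4) (ZMod 2)) + (∏ l, X l ^ (![1, 0, p, q] : Fin 4 → ℕ) l * (1 + X l) ^ (![0, (n + 1), r, s] : Fin 4 → ℕ) l : MvPolynomial (Fin 4) (ZMod 2)) := by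
  have hI := prod_update_e_succ (![0, 0, p, q] : Fin 4 → ℕ) (![0, (n + 1), r, s] : Fin 4 → ℕ) 0
  have h1 : Function.update (![0, (n + 1), r, s] : Fin 4 → ℕ) 0 ((![0, (n + 1), r, s] : Fin 4 → ℕ) 0 + 1) = (![1, (n + 1), r, s] : Fin 4 → ℕ) := by
    funext l; fin_cases l <;> simp
  have h2 : Function.update (![0, 0, p, q] : Fin 4 → ℕ) 0 ((![0, 0, p, q] : Fin 4 → ℕ) 0 + 1) = (![1, 0, p, q] : Fin 4 → ℕ) := by
    funext l; fin_cases l <;> simp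
  rw [h1, h2] at hI
  exact hI

/-- `x₀²x₁^n(1+x₁)·S²` (n even) cleans to `x₀²x₁^{n+1}·S²`. [folklore] -/
theorem clean_G_01 (n p q r s : ℕ) (hn : n % 2 = 0) (hp : p % 2 = 0) (hq : q % 2 = 0) (hr : r % 2 = 0) (hs : s % 2 = 0) :
    deletePthPowers 2 (∏ l, X l ^ (![2, n, p, q] : Fin 4 → ℕ) l * (1 + X l) ^ (![0, 1, r, s] : Fin 4 → ℕ) l : MvPolynomial (Fin 4) (ZMod 2)) = (∏ l, X l ^ (![2, (n + 1), p, q] : Fin 4 → ℕ) l * (1 + X l) ^ (![0, 0, r, s] : Fin 4 → ℕ) l : MvPolynomial (Fin 4) (ZMod 2)) := by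
  have ha : ∀ l, (![2, n, p, q] : Fin 4 → ℕ) l % 2 = 0 := by
    intro l; fin_cases l <;> simp <;> omega
  have he : ∀ l, l ≠ (1 : Fin 4) → (![0, 1, r, s] : Fin 4 → ℕ) l % 2 = 0 := by
    intro l hl; fin_cases l <;> simp at hl ⊢ <;> omega
  rw [clean_even_oddAt _ _ 1 ha he (by simp)]
  congr 1; funext l; fin_cases l <;> simp

/-- `(1+x₁)^{n+1}·S²` (n even) cleans to `x₁(1+x₁)^n·S²`. [folklore] -/
theorem clean_G_10 (n p q r s : ℕ) (hn : n % 2 = 0) (hp : p % 2 = 0) (hq : q % 2 = 0) (hr : r % 2 = 0) (hs : s % 2 = 0) :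
    deletePthPowers 2 (∏ l, X l ^ (![0, 0, p, q] : Fin 4 → ℕ) l * (1 + X l) ^ (![0, (n + 1), r, s] : Fin 4 → ℕ) l : MvPolynomial (Fin 4) (ZMod 2)) = (∏ l, X l ^ (![0, 1, p, q] : Fin 4 → ℕ) l * (1 + X l) ^ (![0, n, r, s] : Fin 4 → ℕ) l : MvPolynomial (Fin 4) (ZMod 2)) := by
  have ha : ∀ l, (![0, 0, p, q] : Fin 4 → ℕ) l % 2 = 0 := by
    intro l; fin_cases l <;> simp <;> omega
  have he : ∀ l, l ≠ (1 : Fin 4) → (![0, (n + 1), r, s] : Fin 4 → ℕ) l % 2 = 0 := by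
    intro l hl; fin_cases l <;> simp at hl ⊢ <;> omega
  rw [clean_even_oddAt _ _ 1 ha he (by simp; omega)]
  congr 1; funext l; fin_cases l <;> simp

/-- `x₁^n(1+x₀)²(1+x₁)·S²` (n even) cleans to `x₁^{n+1}(1+x₀)²·S²`. [folklore] -/
theorem clean_G_11 (n p q r s : ℕ) (hn : n % 2 = 0) (hp : p % 2 = 0) (hq : q % 2 = 0) (hr : r % 2 = 0) (hs : s % 2 = 0) :
    deletePthPowers 2 (∏ l, X l ^ (![0, n, p, q] : Fin 4 → ℕ) l * (1 + X l) ^ (![2, 1, r, s] : Fin 4 → ℕ) l : MvPolynomial (Fin 4) (ZMod 2)) = (∏ l, X l ^ (![0, (n + 1), p, q] : Fin 4 → ℕ) l * (1 + X l) ^ (![2, 0, r, s] : Fin 4 → ℕ) l : MvPolynomial (Fin 4) (ZMod 2)) := by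
  have ha : ∀ l, (![0, n, p, q] : Fin 4 → ℕ) l % 2 = 0 := by
    intro l; fin_cases l <;> simp <;> omega
  have he : ∀ l, l ≠ (1 : Fin 4) → (![2, 1, r, s] : Fin 4 → ℕ) l % 2 = 0 := by
    intro l hl; fin_cases l <;> simp at hl ⊢ <;> omega
  rw [clean_even_oddAt _ _ 1 ha he (by simp)]
  congr 1; funext l; fin_cases l <;> simp

/-- `x₀²(1+x₁)^{n+1}·S²` (n even) cleans to `x₀²x₁(1+x₁)^n·S²`. [folklore] -/
theorem clean_B_1 (n p q r s : ℕ) (hn : n % 2 = 0) (hp : p % 2 = 0) (hq : q % 2 = 0) (hr : r % 2 = 0) (hs : s % 2 = 0) :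
    deletePthPowers 2 (∏ l, X l ^ (![2, 0, p, q] : Fin 4 → ℕ) l * (1 + X l) ^ (![0, (n + 1), r, s] : Fin 4 → ℕ) l : MvPolynomial (Fin 4) (ZMod 2)) = (∏ l, X l ^ (![2, 1, p, q] : Fin 4 → ℕ) l * (1 + X l) ^ (![0, n, r, s] : Fin 4 → ℕ) l : MvPolynomial (Fin 4) (ZMod 2)) := by
  have ha : ∀ l, (![2, 0, p, q] : Fin 4 → ℕ) l % 2 = 0 := by
    intro l; fin_cases l <;> simp <;> omega
  have he : ∀ l, l ≠ (1 : Fin 4) → (![0, (n + 1), r, s] : Fin 4 → ℕ) l % 2 = 0 := by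
    intro l hl; fin_cases l <;> simp at hl ⊢ <;> omega
  rw [clean_even_oddAt _ _ 1 ha he (by simp; omega)]
  congr 1; funext l; fin_cases l <;> simp

/-- `x₀(1+x₀)(1+x₁)^{n+1}·S² = x₀(1+x₁)^{n+1}·S² + x₀²(1+x₁)^{n+1}·S²`. [folklore] -/
theorem split_B1 (n p q r s : ℕ) :
    (∏ l, X l ^ (![1, 0, p, q] : Fin 4 → ℕ) l * (1 + X l) ^ (![1, (n + 1), r, s] : Fin 4 → ℕ) l : MvPolynomial (Fin 4) (ZMod 2)) = (∏ l, X l ^ (![1, 0, p, q] : Fin 4 → ℕ) l * (1 + X l) ^ (![0, (n + 1), r, s] : Fin 4 → ℕ) l : MvPolynomial (Fin 4) (ZMod 2)) + (∏ l, X l ^ (![2, 0, p, q] : Fin 4 → ℕ) l * (1 + X l) ^ (![0, (n + 1), r, s] : Fin 4 → ℕ) l : MvPolynomial (Fin 4) (ZMod 2)) := by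
  have hI := prod_update_e_succ (![1, 0, p, q] : Fin 4 → ℕ) (![0, (n + 1), r, s] : Fin 4 → ℕ) 0
  have h1 : Function.update (![0, (n + 1), r, s] : Fin 4 → ℕ) 0 ((![0, (n + 1), r, s] : Fin 4 → ℕ) 0 + 1) = (![1, (n + 1), r, s] : Fin 4 → ℕ) := by
    funext l; fin_cases l <;> simp
  have h2 : Function.update (![1, 0, p, q] : Fin 4 → ℕ) 0 ((![1, 0, p, q] : Fin 4 → ℕ) 0 + 1) = (![2, 0, p, q] : Fin 4 → ℕ) := by
    funext l; fin_cases l <;> simp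
  rw [h1, h2] at hI
  exact hI

/-! ## 3. The grind transitions at `G̃·S²` and the first move at `B·S²` -/

/-- **Grind transition at `G̃·S²`, chart `x₂`**: `G̃·S′²` if `b₁ = 0`, the `a₀ = 1` leaf shape `A·S′²` if `b₁ = 1`. [folklore] -/
theorem step_F_grind2_G (n g2 g3 e2 e3 : ℕ) (hn : n % 2 = 0) (hg2 : g2 % 2 = 0) (hg3 : g3 % 2 = 0) (he2 : e2 % 2 = 0) (he3 : e3 % 2 = 0) (hg2i : 2 ≤ g2)
    (b : Fin 4 → ZMod 2) (hb : b 2 = 0) (r : Fin 4 →₀ ℕ) (exc : Finset (Fin 4)) :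
    ((step 2 {2} 2 b (⟨((∏ l, X l ^ (![1, 0, g2, g3] : Fin 4 → ℕ) l * (1 + X l) ^ (![0, (n + 1), e2, e3] : Fin 4 → ℕ) l : MvPolynomial (Fin 4) (ZMod 2)) + (∏ l, X l ^ (![2, 1, g2, g3] : Fin 4 → ℕ) l * (1 + X l) ^ (![0, n, e2, e3] : Fin 4 → ℕ) l : MvPolynomial (Fin 4) (ZMod 2))), r, exc⟩ : State (ZMod 2))).F =
        ((∏ l, X l ^ (![1, 0, (g2 - 2), (if b 3 = 0 then g3 else e3)] : Fin 4 → ℕ) l * (1 + X l) ^ (![0, (n + 1), e2, (if b 3 = 0 then e3 else g3)] : Fin 4 → ℕ) l : MvPolynomial (Fin 4) (ZMod 2)) + (∏ l, X l ^ (![2, 1, (g2 - 2), (if b 3 = 0 then g3 else e3)] : Fin 4 → ℕ) l * (1 + X l) ^ (![0, n, e2, (if b 3 = 0 then e3 else g3)] : Fin 4 → ℕ) l : MvPolynomial (Fin 4) (ZMod 2))) ∧ b 1 = 0) ∨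
    ((step 2 {2} 2 b (⟨((∏ l, X l ^ (![1, 0, g2, g3] : Fin 4 → ℕ) l * (1 + X l) ^ (![0, (n + 1), e2, e3] : Fin 4 → ℕ) l : MvPolynomial (Fin 4) (ZMod 2)) + (∏ l, X l ^ (![2, 1, g2, g3] : Fin 4 → ℕ) l * (1 + X l) ^ (![0, n, e2, e3] : Fin 4 → ℕ) l : MvPolynomial (Fin 4) (ZMod 2))), r, exc⟩ : State (ZMod 2))).F =
        (∏ l, X l ^ (![1, (n + 1), (g2 - 2), (if b 3 = 0 then g3 else e3)] : Fin 4 → ℕ) l * (1 + X l) ^ (![1, 0, e2, (if b 3 = 0 then e3 else g3)] : Fin 4 → ℕ) l : MvPolynomial (Fin 4) (ZMod 2)) ∧ b 1 = 1) := by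
  have hP : ∀ u : ℕ, u % 2 = 0 → ∀ v : ℕ, v % 2 = 0 → (if b 3 = 0 then u else v) % 2 = 0 := by
    intro u hu v hv; split_ifs <;> assumption
  have hp' : (g2 - 2) % 2 = 0 := by omega
  have hq' : (if b 3 = 0 then g3 else e3) % 2 = 0 := by exact hP _ hg3 _ he3
  have hr' : e2 % 2 = 0 := by omega
  have hs' : (if b 3 = 0 then e3 else g3) % 2 = 0 := by exact hP _ he3 _ hg3
  change deletePthPowers 2 (PointBlowup.translate b (chartTransform 2 {2} 2 ((∏ l, X l ^ (![1, 0, g2, g3] : Fin 4 → ℕ) l * (1 + X l) ^ (![0, (n + 1), e2, e3] : Fin 4 → ℕ) l : MvPolynomial (Fin 4) (ZMod 2)) + (∏ l, X l ^ (![2, 1, g2, g3] : Fin 4 → ℕ) l * (1 + X l) ^ (![0, n, e2, e3] : Fin 4 → ℕ) l : MvPolynomial (Fin 4) (ZMod 2))))) = _ ∧ _ ∨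
    deletePthPowers 2 (PointBlowup.translate b (chartTransform 2 {2} 2 ((∏ l, X l ^ (![1, 0, g2, g3] : Fin 4 → ℕ) l * (1 + X l) ^ (![0, (n + 1), e2, e3] : Fin 4 → ℕ) l : MvPolynomial (Fin 4) (ZMod 2)) + (∏ l, X l ^ (![2, 1, g2, g3] : Fin 4 → ℕ) l * (1 + X l) ^ (![0, n, e2, e3] : Fin 4 → ℕ) l : MvPolynomial (Fin 4) (ZMod 2))))) = _ ∧ _
  simp only [chartTransform_add, MohAlong.translate_add, deletePthPowers_add]
  rw [translate_chartTransform_singleton_prod (![1, 0, g2, g3] : Fin 4 → ℕ) (![0, (n + 1), e2, e3] : Fin 4 → ℕ) (i := 2) (by simpa using hg2i) b,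
    translate_chartTransform_singleton_prod (![2, 1, g2, g3] : Fin 4 → ℕ) (![0, n, e2, e3] : Fin 4 → ℕ) (i := 2) (by simpa using hg2i) b]
  rcases (by decide : ∀ z : ZMod 2, z = 0 ∨ z = 1) (b 0) with h0 | h0 <;>
    rcases (by decide : ∀ z : ZMod 2, z = 0 ∨ z = 1) (b 1) with h1 | h1
  · -- case b₀ = 0, b₁ = 0
    left
    refine ⟨?_, h1⟩
    rw [show (∏ l, X l ^ (if b l = 0 then Function.update (![1, 0, g2, g3] : Fin 4 → ℕ) 2 ((![1, 0, g2, g3] : Fin 4 → ℕ) 2 - 2) l else (![0, (n + 1), e2, e3] : Fin 4 → ℕ) l) *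
        (1 + X l) ^ (if b l = 0 then (![0, (n + 1), e2, e3] : Fin 4 → ℕ) l else Function.update (![1, 0, g2, g3] : Fin 4 → ℕ) 2 ((![1, 0, g2, g3] : Fin 4 → ℕ) 2 - 2) l) : MvPolynomial (Fin 4) (ZMod 2)) =
        (∏ l, X l ^ (![1, 0, (g2 - 2), (if b 3 = 0 then g3 else e3)] : Fin 4 → ℕ) l * (1 + X l) ^ (![0, (n + 1), e2, (if b 3 = 0 then e3 else g3)] : Fin 4 → ℕ) l : MvPolynomial (Fin 4) (ZMod 2)) from
      Finset.prod_congr rfl fun l _ => by fin_cases l <;> simp [h0, h1, hb]]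
    rw [show (∏ l, X l ^ (if b l = 0 then Function.update (![2, 1, g2, g3] : Fin 4 → ℕ) 2 ((![2, 1, g2, g3] : Fin 4 → ℕ) 2 - 2) l else (![0, n, e2, e3] : Fin 4 → ℕ) l) *
        (1 + X l) ^ (if b l = 0 then (![0, n, e2, e3] : Fin 4 → ℕ) l else Function.update (![2, 1, g2, g3] : Fin 4 → ℕ) 2 ((![2, 1, g2, g3] : Fin 4 → ℕ) 2 - 2) l) : MvPolynomial (Fin 4) (ZMod 2)) =
        (∏ l, X l ^ (![2, 1, (g2 - 2), (if b 3 = 0 then g3 else e3)] : Fin 4 → ℕ) l * (1 + X l) ^ (![0, n, e2, (if b 3 = 0 then e3 else g3)] : Fin 4 → ℕ) l : MvPolynomial (Fin 4) (ZMod 2)) from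
      Finset.prod_congr rfl fun l _ => by fin_cases l <;> simp [h0, h1, hb]]
    rw [deletePthPowers_prod_of_purelyOdd (![1, 0, (g2 - 2), (if b 3 = 0 then g3 else e3)] : Fin 4 → ℕ) (![0, (n + 1), e2, (if b 3 = 0 then e3 else g3)] : Fin 4 → ℕ) (l := 0) (by simp) (by simp),
      deletePthPowers_prod_of_purelyOdd (![2, 1, (g2 - 2), (if b 3 = 0 then g3 else e3)] : Fin 4 → ℕ) (![0, n, e2, (if b 3 = 0 then e3 else g3)] : Fin 4 → ℕ) (l := 1) (by simp) (by simpa using hn)]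
  · -- case b₀ = 0, b₁ = 1
    right
    refine ⟨?_, h1⟩
    rw [show (∏ l, X l ^ (if b l = 0 then Function.update (![1, 0, g2, g3] : Fin 4 → ℕ) 2 ((![1, 0, g2, g3] : Fin 4 → ℕ) 2 - 2) l else (![0, (n + 1), e2, e3] : Fin 4 → ℕ) l) *
        (1 + X l) ^ (if b l = 0 then (![0, (n + 1), e2, e3] : Fin 4 → ℕ) l else Function.update (![1, 0, g2, g3] : Fin 4 → ℕ) 2 ((![1, 0, g2, g3] : Fin 4 → ℕ) 2 - 2) l) : MvPolynomial (Fin 4) (ZMod 2)) =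
        (∏ l, X l ^ (![1, (n + 1), (g2 - 2), (if b 3 = 0 then g3 else e3)] : Fin 4 → ℕ) l * (1 + X l) ^ (![0, 0, e2, (if b 3 = 0 then e3 else g3)] : Fin 4 → ℕ) l : MvPolynomial (Fin 4) (ZMod 2)) from
      Finset.prod_congr rfl fun l _ => by fin_cases l <;> simp [h0, h1, hb]]
    rw [show (∏ l, X l ^ (if b l = 0 then Function.update (![2, 1, g2, g3] : Fin 4 → ℕ) 2 ((![2, 1, g2, g3] : Fin 4 → ℕ) 2 - 2) l else (![0, n, e2, e3] : Fin 4 → ℕ) l) *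
        (1 + X l) ^ (if b l = 0 then (![0, n, e2, e3] : Fin 4 → ℕ) l else Function.update (![2, 1, g2, g3] : Fin 4 → ℕ) 2 ((![2, 1, g2, g3] : Fin 4 → ℕ) 2 - 2) l) : MvPolynomial (Fin 4) (ZMod 2)) =
        (∏ l, X l ^ (![2, n, (g2 - 2), (if b 3 = 0 then g3 else e3)] : Fin 4 → ℕ) l * (1 + X l) ^ (![0, 1, e2, (if b 3 = 0 then e3 else g3)] : Fin 4 → ℕ) l : MvPolynomial (Fin 4) (ZMod 2)) from
      Finset.prod_congr rfl fun l _ => by fin_cases l <;> simp [h0, h1, hb]]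
    rw [deletePthPowers_prod_of_purelyOdd (![1, (n + 1), (g2 - 2), (if b 3 = 0 then g3 else e3)] : Fin 4 → ℕ) (![0, 0, e2, (if b 3 = 0 then e3 else g3)] : Fin 4 → ℕ) (l := 0) (by simp) (by simp),
      clean_G_01 _ _ _ _ _ hn hp' hq' hr' hs', A_eq_add]
  · -- case b₀ = 1, b₁ = 0
    left
    refine ⟨?_, h1⟩
    rw [show (∏ l, X l ^ (if b l = 0 then Function.update (![1, 0, g2, g3] : Fin 4 → ℕ) 2 ((![1, 0, g2, g3] : Fin 4 → ℕ) 2 - 2) l else (![0, (n + 1), e2, e3] : Fin 4 → ℕ) l) *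
        (1 + X l) ^ (if b l = 0 then (![0, (n + 1), e2, e3] : Fin 4 → ℕ) l else Function.update (![1, 0, g2, g3] : Fin 4 → ℕ) 2 ((![1, 0, g2, g3] : Fin 4 → ℕ) 2 - 2) l) : MvPolynomial (Fin 4) (ZMod 2)) =
        (∏ l, X l ^ (![0, 0, (g2 - 2), (if b 3 = 0 then g3 else e3)] : Fin 4 → ℕ) l * (1 + X l) ^ (![1, (n + 1), e2, (if b 3 = 0 then e3 else g3)] : Fin 4 → ℕ) l : MvPolynomial (Fin 4) (ZMod 2)) from
      Finset.prod_congr rfl fun l _ => by fin_cases l <;> simp [h0, h1, hb]]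
    rw [show (∏ l, X l ^ (if b l = 0 then Function.update (![2, 1, g2, g3] : Fin 4 → ℕ) 2 ((![2, 1, g2, g3] : Fin 4 → ℕ) 2 - 2) l else (![0, n, e2, e3] : Fin 4 → ℕ) l) *
        (1 + X l) ^ (if b l = 0 then (![0, n, e2, e3] : Fin 4 → ℕ) l else Function.update (![2, 1, g2, g3] : Fin 4 → ℕ) 2 ((![2, 1, g2, g3] : Fin 4 → ℕ) 2 - 2) l) : MvPolynomial (Fin 4) (ZMod 2)) =
        (∏ l, X l ^ (![0, 1, (g2 - 2), (if b 3 = 0 then g3 else e3)] : Fin 4 → ℕ) l * (1 + X l) ^ (![2, n, e2, (if b 3 = 0 then e3 else g3)] : Fin 4 → ℕ) l : MvPolynomial (Fin 4) (ZMod 2)) from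
      Finset.prod_congr rfl fun l _ => by fin_cases l <;> simp [h0, h1, hb]]
    rw [split_d0_G, deletePthPowers_add, clean_G_10 _ _ _ _ _ hn hp' hq' hr' hs',
      deletePthPowers_prod_of_purelyOdd (![1, 0, (g2 - 2), (if b 3 = 0 then g3 else e3)] : Fin 4 → ℕ) (![0, (n + 1), e2, (if b 3 = 0 then e3 else g3)] : Fin 4 → ℕ) (l := 0) (by simp) (by simp),
      deletePthPowers_prod_of_purelyOdd (![0, 1, (g2 - 2), (if b 3 = 0 then g3 else e3)] : Fin 4 → ℕ) (![2, n, e2, (if b 3 = 0 then e3 else g3)] : Fin 4 → ℕ) (l := 1) (by simp) (by simpa using hn),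
      split_dsq0_n]
    have hc := add_self_eq_zero' (∏ l, X l ^ (![0, 1, (g2 - 2), (if b 3 = 0 then g3 else e3)] : Fin 4 → ℕ) l * (1 + X l) ^ (![0, n, e2, (if b 3 = 0 then e3 else g3)] : Fin 4 → ℕ) l : MvPolynomial (Fin 4) (ZMod 2))
    linear_combination hc
  · -- case b₀ = 1, b₁ = 1
    right
    refine ⟨?_, h1⟩
    rw [show (∏ l, X l ^ (if b l = 0 then Function.update (![1, 0, g2, g3] : Fin 4 → ℕ) 2 ((![1, 0, g2, g3] : Fin 4 → ℕ) 2 - 2) l else (![0, (n + 1), e2, e3] : Fin 4 → ℕ) l) *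
        (1 + X l) ^ (if b l = 0 then (![0, (n + 1), e2, e3] : Fin 4 → ℕ) l else Function.update (![1, 0, g2, g3] : Fin 4 → ℕ) 2 ((![1, 0, g2, g3] : Fin 4 → ℕ) 2 - 2) l) : MvPolynomial (Fin 4) (ZMod 2)) =
        (∏ l, X l ^ (![0, (n + 1), (g2 - 2), (if b 3 = 0 then g3 else e3)] : Fin 4 → ℕ) l * (1 + X l) ^ (![1, 0, e2, (if b 3 = 0 then e3 else g3)] : Fin 4 → ℕ) l : MvPolynomial (Fin 4) (ZMod 2)) from
      Finset.prod_congr rfl fun l _ => by fin_cases l <;> simp [h0, h1, hb]]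
    rw [show (∏ l, X l ^ (if b l = 0 then Function.update (![2, 1, g2, g3] : Fin 4 → ℕ) 2 ((![2, 1, g2, g3] : Fin 4 → ℕ) 2 - 2) l else (![0, n, e2, e3] : Fin 4 → ℕ) l) *
        (1 + X l) ^ (if b l = 0 then (![0, n, e2, e3] : Fin 4 → ℕ) l else Function.update (![2, 1, g2, g3] : Fin 4 → ℕ) 2 ((![2, 1, g2, g3] : Fin 4 → ℕ) 2 - 2) l) : MvPolynomial (Fin 4) (ZMod 2)) =
        (∏ l, X l ^ (![0, n, (g2 - 2), (if b 3 = 0 then g3 else e3)] : Fin 4 → ℕ) l * (1 + X l) ^ (![2, 1, e2, (if b 3 = 0 then e3 else g3)] : Fin 4 → ℕ) l : MvPolynomial (Fin 4) (ZMod 2)) from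
      Finset.prod_congr rfl fun l _ => by fin_cases l <;> simp [h0, h1, hb]]
    rw [deletePthPowers_prod_of_purelyOdd (![0, (n + 1), (g2 - 2), (if b 3 = 0 then g3 else e3)] : Fin 4 → ℕ) (![1, 0, e2, (if b 3 = 0 then e3 else g3)] : Fin 4 → ℕ) (l := 1) (by simp; omega) (by simp),
      clean_G_11 _ _ _ _ _ hn hp' hq' hr' hs', split_d0_m, split_dsq0_m, A_eq_add]
    have hc := add_self_eq_zero' (∏ l, X l ^ (![0, (n + 1), (g2 - 2), (if b 3 = 0 then g3 else e3)] : Fin 4 → ℕ) l * (1 + X l) ^ (![0, 0, e2, (if b 3 = 0 then e3 else g3)] : Fin 4 → ℕ) l : MvPolynomial (Fin 4) (ZMod 2))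
    linear_combination hc

/-- **Grind transition at `G̃·S²`, chart `x₃`**: `G̃·S′²` if `b₁ = 0`, the `a₀ = 1` leaf shape `A·S′²` if `b₁ = 1`. [folklore] -/
theorem step_F_grind3_G (n g2 g3 e2 e3 : ℕ) (hn : n % 2 = 0) (hg2 : g2 % 2 = 0) (hg3 : g3 % 2 = 0) (he2 : e2 % 2 = 0) (he3 : e3 % 2 = 0) (hg3i : 2 ≤ g3)
    (b : Fin 4 → ZMod 2) (hb : b 3 = 0) (r : Fin 4 →₀ ℕ) (exc : Finset (Fin 4)) :
    ((step 2 {3} 3 b (⟨((∏ l, X l ^ (![1, 0, g2, g3] : Fin 4 → ℕ) l * (1 + X l) ^ (![0, (n + 1), e2, e3] : Fin 4 → ℕ) l : MvPolynomial (Fin 4) (ZMod 2)) + (∏ l, X l ^ (![2, 1, g2, g3] : Fin 4 → ℕ) l * (1 + X l) ^ (![0, n, e2, e3] : Fin 4 → ℕ) l : MvPolynomial (Fin 4) (ZMod 2))), r, exc⟩ : State (ZMod 2))).F =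
        ((∏ l, X l ^ (![1, 0, (if b 2 = 0 then g2 else e2), (g3 - 2)] : Fin 4 → ℕ) l * (1 + X l) ^ (![0, (n + 1), (if b 2 = 0 then e2 else g2), e3] : Fin 4 → ℕ) l : MvPolynomial (Fin 4) (ZMod 2)) + (∏ l, X l ^ (![2, 1, (if b 2 = 0 then g2 else e2), (g3 - 2)] : Fin 4 → ℕ) l * (1 + X l) ^ (![0, n, (if b 2 = 0 then e2 else g2), e3] : Fin 4 → ℕ) l : MvPolynomial (Fin 4) (ZMod 2))) ∧ b 1 = 0) ∨
    ((step 2 {3} 3 b (⟨((∏ l, X l ^ (![1, 0, g2, g3] : Fin 4 → ℕ) l * (1 + X l) ^ (![0, (n + 1), e2, e3] : Fin 4 → ℕ) l : MvPolynomial (Fin 4) (ZMod 2)) + (∏ l, X l ^ (![2, 1, g2, g3] : Fin 4 → ℕ) l * (1 + X l) ^ (![0, n, e2, e3] : Fin 4 → ℕ) l : MvPolynomial (Fin 4) (ZMod 2))), r, exc⟩ : State (ZMod 2))).F =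
        (∏ l, X l ^ (![1, (n + 1), (if b 2 = 0 then g2 else e2), (g3 - 2)] : Fin 4 → ℕ) l * (1 + X l) ^ (![1, 0, (if b 2 = 0 then e2 else g2), e3] : Fin 4 → ℕ) l : MvPolynomial (Fin 4) (ZMod 2)) ∧ b 1 = 1) := by
  have hP : ∀ u : ℕ, u % 2 = 0 → ∀ v : ℕ, v % 2 = 0 → (if b 2 = 0 then u else v) % 2 = 0 := by
    intro u hu v hv; split_ifs <;> assumption
  have hp' : (if b 2 = 0 then g2 else e2) % 2 = 0 := by exact hP _ hg2 _ he2
  have hq' : (g3 - 2) % 2 = 0 := by omega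
  have hr' : (if b 2 = 0 then e2 else g2) % 2 = 0 := by exact hP _ he2 _ hg2
  have hs' : e3 % 2 = 0 := by omega
  change deletePthPowers 2 (PointBlowup.translate b (chartTransform 2 {3} 3 ((∏ l, X l ^ (![1, 0, g2, g3] : Fin 4 → ℕ) l * (1 + X l) ^ (![0, (n + 1), e2, e3] : Fin 4 → ℕ) l : MvPolynomial (Fin 4) (ZMod 2)) + (∏ l, X l ^ (![2, 1, g2, g3] : Fin 4 → ℕ) l * (1 + X l) ^ (![0, n, e2, e3] : Fin 4 → ℕ) l : MvPolynomial (Fin 4) (ZMod 2))))) = _ ∧ _ ∨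
    deletePthPowers 2 (PointBlowup.translate b (chartTransform 2 {3} 3 ((∏ l, X l ^ (![1, 0, g2, g3] : Fin 4 → ℕ) l * (1 + X l) ^ (![0, (n + 1), e2, e3] : Fin 4 → ℕ) l : MvPolynomial (Fin 4) (ZMod 2)) + (∏ l, X l ^ (![2, 1, g2, g3] : Fin 4 → ℕ) l * (1 + X l) ^ (![0, n, e2, e3] : Fin 4 → ℕ) l : MvPolynomial (Fin 4) (ZMod 2))))) = _ ∧ _
  simp only [chartTransform_add, MohAlong.translate_add, deletePthPowers_add]
  rw [translate_chartTransform_singleton_prod (![1, 0, g2, g3] : Fin 4 → ℕ) (![0, (n + 1), e2, e3] : Fin 4 → ℕ) (i := 3) (by simpa using hg3i) b,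
    translate_chartTransform_singleton_prod (![2, 1, g2, g3] : Fin 4 → ℕ) (![0, n, e2, e3] : Fin 4 → ℕ) (i := 3) (by simpa using hg3i) b]
  rcases (by decide : ∀ z : ZMod 2, z = 0 ∨ z = 1) (b 0) with h0 | h0 <;>
    rcases (by decide : ∀ z : ZMod 2, z = 0 ∨ z = 1) (b 1) with h1 | h1
  · -- case b₀ = 0, b₁ = 0
    left
    refine ⟨?_, h1⟩
    rw [show (∏ l, X l ^ (if b l = 0 then Function.update (![1, 0, g2, g3] : Fin 4 → ℕ) 3 ((![1, 0, g2, g3] : Fin 4 → ℕ) 3 - 2) l else (![0, (n + 1), e2, e3] : Fin 4 → ℕ) l) *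
        (1 + X l) ^ (if b l = 0 then (![0, (n + 1), e2, e3] : Fin 4 → ℕ) l else Function.update (![1, 0, g2, g3] : Fin 4 → ℕ) 3 ((![1, 0, g2, g3] : Fin 4 → ℕ) 3 - 2) l) : MvPolynomial (Fin 4) (ZMod 2)) =
        (∏ l, X l ^ (![1, 0, (if b 2 = 0 then g2 else e2), (g3 - 2)] : Fin 4 → ℕ) l * (1 + X l) ^ (![0, (n + 1), (if b 2 = 0 then e2 else g2), e3] : Fin 4 → ℕ) l : MvPolynomial (Fin 4) (ZMod 2)) from
      Finset.prod_congr rfl fun l _ => by fin_cases l <;> simp [h0, h1, hb]]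
    rw [show (∏ l, X l ^ (if b l = 0 then Function.update (![2, 1, g2, g3] : Fin 4 → ℕ) 3 ((![2, 1, g2, g3] : Fin 4 → ℕ) 3 - 2) l else (![0, n, e2, e3] : Fin 4 → ℕ) l) *
        (1 + X l) ^ (if b l = 0 then (![0, n, e2, e3] : Fin 4 → ℕ) l else Function.update (![2, 1, g2, g3] : Fin 4 → ℕ) 3 ((![2, 1, g2, g3] : Fin 4 → ℕ) 3 - 2) l) : MvPolynomial (Fin 4) (ZMod 2)) =
        (∏ l, X l ^ (![2, 1, (if b 2 = 0 then g2 else e2), (g3 - 2)] : Fin 4 → ℕ) l * (1 + X l) ^ (![0, n, (if b 2 = 0 then e2 else g2), e3] : Fin 4 → ℕ) l : MvPolynomial (Fin 4) (ZMod 2)) from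
      Finset.prod_congr rfl fun l _ => by fin_cases l <;> simp [h0, h1, hb]]
    rw [deletePthPowers_prod_of_purelyOdd (![1, 0, (if b 2 = 0 then g2 else e2), (g3 - 2)] : Fin 4 → ℕ) (![0, (n + 1), (if b 2 = 0 then e2 else g2), e3] : Fin 4 → ℕ) (l := 0) (by simp) (by simp),
      deletePthPowers_prod_of_purelyOdd (![2, 1, (if b 2 = 0 then g2 else e2), (g3 - 2)] : Fin 4 → ℕ) (![0, n, (if b 2 = 0 then e2 else g2), e3] : Fin 4 → ℕ) (l := 1) (by simp) (by simpa using hn)]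
  · -- case b₀ = 0, b₁ = 1
    right
    refine ⟨?_, h1⟩
    rw [show (∏ l, X l ^ (if b l = 0 then Function.update (![1, 0, g2, g3] : Fin 4 → ℕ) 3 ((![1, 0, g2, g3] : Fin 4 → ℕ) 3 - 2) l else (![0, (n + 1), e2, e3] : Fin 4 → ℕ) l) *
        (1 + X l) ^ (if b l = 0 then (![0, (n + 1), e2, e3] : Fin 4 → ℕ) l else Function.update (![1, 0, g2, g3] : Fin 4 → ℕ) 3 ((![1, 0, g2, g3] : Fin 4 → ℕ) 3 - 2) l) : MvPolynomial (Fin 4) (ZMod 2)) =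
        (∏ l, X l ^ (![1, (n + 1), (if b 2 = 0 then g2 else e2), (g3 - 2)] : Fin 4 → ℕ) l * (1 + X l) ^ (![0, 0, (if b 2 = 0 then e2 else g2), e3] : Fin 4 → ℕ) l : MvPolynomial (Fin 4) (ZMod 2)) from
      Finset.prod_congr rfl fun l _ => by fin_cases l <;> simp [h0, h1, hb]]
    rw [show (∏ l, X l ^ (if b l = 0 then Function.update (![2, 1, g2, g3] : Fin 4 → ℕ) 3 ((![2, 1, g2, g3] : Fin 4 → ℕ) 3 - 2) l else (![0, n, e2, e3] : Fin 4 → ℕ) l) *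
        (1 + X l) ^ (if b l = 0 then (![0, n, e2, e3] : Fin 4 → ℕ) l else Function.update (![2, 1, g2, g3] : Fin 4 → ℕ) 3 ((![2, 1, g2, g3] : Fin 4 → ℕ) 3 - 2) l) : MvPolynomial (Fin 4) (ZMod 2)) =
        (∏ l, X l ^ (![2, n, (if b 2 = 0 then g2 else e2), (g3 - 2)] : Fin 4 → ℕ) l * (1 + X l) ^ (![0, 1, (if b 2 = 0 then e2 else g2), e3] : Fin 4 → ℕ) l : MvPolynomial (Fin 4) (ZMod 2)) from
      Finset.prod_congr rfl fun l _ => by fin_cases l <;> simp [h0, h1, hb]]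
    rw [deletePthPowers_prod_of_purelyOdd (![1, (n + 1), (if b 2 = 0 then g2 else e2), (g3 - 2)] : Fin 4 → ℕ) (![0, 0, (if b 2 = 0 then e2 else g2), e3] : Fin 4 → ℕ) (l := 0) (by simp) (by simp),
      clean_G_01 _ _ _ _ _ hn hp' hq' hr' hs', A_eq_add]
  · -- case b₀ = 1, b₁ = 0
    left
    refine ⟨?_, h1⟩
    rw [show (∏ l, X l ^ (if b l = 0 then Function.update (![1, 0, g2, g3] : Fin 4 → ℕ) 3 ((![1, 0, g2, g3] : Fin 4 → ℕ) 3 - 2) l else (![0, (n + 1), e2, e3] : Fin 4 → ℕ) l) *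
        (1 + X l) ^ (if b l = 0 then (![0, (n + 1), e2, e3] : Fin 4 → ℕ) l else Function.update (![1, 0, g2, g3] : Fin 4 → ℕ) 3 ((![1, 0, g2, g3] : Fin 4 → ℕ) 3 - 2) l) : MvPolynomial (Fin 4) (ZMod 2)) =
        (∏ l, X l ^ (![0, 0, (if b 2 = 0 then g2 else e2), (g3 - 2)] : Fin 4 → ℕ) l * (1 + X l) ^ (![1, (n + 1), (if b 2 = 0 then e2 else g2), e3] : Fin 4 → ℕ) l : MvPolynomial (Fin 4) (ZMod 2)) from
      Finset.prod_congr rfl fun l _ => by fin_cases l <;> simp [h0, h1, hb]]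
    rw [show (∏ l, X l ^ (if b l = 0 then Function.update (![2, 1, g2, g3] : Fin 4 → ℕ) 3 ((![2, 1, g2, g3] : Fin 4 → ℕ) 3 - 2) l else (![0, n, e2, e3] : Fin 4 → ℕ) l) *
        (1 + X l) ^ (if b l = 0 then (![0, n, e2, e3] : Fin 4 → ℕ) l else Function.update (![2, 1, g2, g3] : Fin 4 → ℕ) 3 ((![2, 1, g2, g3] : Fin 4 → ℕ) 3 - 2) l) : MvPolynomial (Fin 4) (ZMod 2)) =
        (∏ l, X l ^ (![0, 1, (if b 2 = 0 then g2 else e2), (g3 - 2)] : Fin 4 → ℕ) l * (1 + X l) ^ (![2, n, (if b 2 = 0 then e2 else g2), e3] : Fin 4 → ℕ) l : MvPolynomial (Fin 4) (ZMod 2)) from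
      Finset.prod_congr rfl fun l _ => by fin_cases l <;> simp [h0, h1, hb]]
    rw [split_d0_G, deletePthPowers_add, clean_G_10 _ _ _ _ _ hn hp' hq' hr' hs',
      deletePthPowers_prod_of_purelyOdd (![1, 0, (if b 2 = 0 then g2 else e2), (g3 - 2)] : Fin 4 → ℕ) (![0, (n + 1), (if b 2 = 0 then e2 else g2), e3] : Fin 4 → ℕ) (l := 0) (by simp) (by simp),
      deletePthPowers_prod_of_purelyOdd (![0, 1, (if b 2 = 0 then g2 else e2), (g3 - 2)] : Fin 4 → ℕ) (![2, n, (if b 2 = 0 then e2 else g2), e3] : Fin 4 → ℕ) (l := 1) (by simp) (by simpa using hn),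
      split_dsq0_n]
    have hc := add_self_eq_zero' (∏ l, X l ^ (![0, 1, (if b 2 = 0 then g2 else e2), (g3 - 2)] : Fin 4 → ℕ) l * (1 + X l) ^ (![0, n, (if b 2 = 0 then e2 else g2), e3] : Fin 4 → ℕ) l : MvPolynomial (Fin 4) (ZMod 2))
    linear_combination hc
  · -- case b₀ = 1, b₁ = 1
    right
    refine ⟨?_, h1⟩
    rw [show (∏ l, X l ^ (if b l = 0 then Function.update (![1, 0, g2, g3] : Fin 4 → ℕ) 3 ((![1, 0, g2, g3] : Fin 4 → ℕ) 3 - 2) l else (![0, (n + 1), e2, e3] : Fin 4 → ℕ) l) *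
        (1 + X l) ^ (if b l = 0 then (![0, (n + 1), e2, e3] : Fin 4 → ℕ) l else Function.update (![1, 0, g2, g3] : Fin 4 → ℕ) 3 ((![1, 0, g2, g3] : Fin 4 → ℕ) 3 - 2) l) : MvPolynomial (Fin 4) (ZMod 2)) =
        (∏ l, X l ^ (![0, (n + 1), (if b 2 = 0 then g2 else e2), (g3 - 2)] : Fin 4 → ℕ) l * (1 + X l) ^ (![1, 0, (if b 2 = 0 then e2 else g2), e3] : Fin 4 → ℕ) l : MvPolynomial (Fin 4) (ZMod 2)) from
      Finset.prod_congr rfl fun l _ => by fin_cases l <;> simp [h0, h1, hb]]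
    rw [show (∏ l, X l ^ (if b l = 0 then Function.update (![2, 1, g2, g3] : Fin 4 → ℕ) 3 ((![2, 1, g2, g3] : Fin 4 → ℕ) 3 - 2) l else (![0, n, e2, e3] : Fin 4 → ℕ) l) *
        (1 + X l) ^ (if b l = 0 then (![0, n, e2, e3] : Fin 4 → ℕ) l else Function.update (![2, 1, g2, g3] : Fin 4 → ℕ) 3 ((![2, 1, g2, g3] : Fin 4 → ℕ) 3 - 2) l) : MvPolynomial (Fin 4) (ZMod 2)) =
        (∏ l, X l ^ (![0, n, (if b 2 = 0 then g2 else e2), (g3 - 2)] : Fin 4 → ℕ) l * (1 + X l) ^ (![2, 1, (if b 2 = 0 then e2 else g2), e3] : Fin 4 → ℕ) l : MvPolynomial (Fin 4) (ZMod 2)) from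
      Finset.prod_congr rfl fun l _ => by fin_cases l <;> simp [h0, h1, hb]]
    rw [deletePthPowers_prod_of_purelyOdd (![0, (n + 1), (if b 2 = 0 then g2 else e2), (g3 - 2)] : Fin 4 → ℕ) (![1, 0, (if b 2 = 0 then e2 else g2), e3] : Fin 4 → ℕ) (l := 1) (by simp; omega) (by simp),
      clean_G_11 _ _ _ _ _ hn hp' hq' hr' hs', split_d0_m, split_dsq0_m, A_eq_add]
    have hc := add_self_eq_zero' (∏ l, X l ^ (![0, (n + 1), (if b 2 = 0 then g2 else e2), (g3 - 2)] : Fin 4 → ℕ) l * (1 + X l) ^ (![0, 0, (if b 2 = 0 then e2 else g2), e3] : Fin 4 → ℕ) l : MvPolynomial (Fin 4) (ZMod 2))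
    linear_combination hc

/-- **First move at `B·S² = x₀³x₁^m(1+x₀)·S²`** (centre `{x₀}`): the reply presents the `a₀ = 1` leaf shape `A·S′²` (if `b₁ = 0`) or
`G̃·S′²` (if `b₁ = 1`). [folklore] -/
theorem step_F_grind0_B (n g2 g3 e2 e3 : ℕ) (hn : n % 2 = 0) (hg2 : g2 % 2 = 0) (hg3 : g3 % 2 = 0) (he2 : e2 % 2 = 0) (he3 : e3 % 2 = 0)
    (b : Fin 4 → ZMod 2) (hb : b 0 = 0) (r : Fin 4 →₀ ℕ) (exc : Finset (Fin 4)) :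
    ((step 2 ({0} : Finset (Fin 4)) 0 b (⟨(∏ l, X l ^ (![3, (n + 1), g2, g3] : Fin 4 → ℕ) l * (1 + X l) ^ (![1, 0, e2, e3] : Fin 4 → ℕ) l : MvPolynomial (Fin 4) (ZMod 2)), r, exc⟩ : State (ZMod 2))).F =
        (∏ l, X l ^ (![1, (n + 1), (if b 2 = 0 then g2 else e2), (if b 3 = 0 then g3 else e3)] : Fin 4 → ℕ) l * (1 + X l) ^ (![1, 0, (if b 2 = 0 then e2 else g2), (if b 3 = 0 then e3 else g3)] : Fin 4 → ℕ) l : MvPolynomial (Fin 4) (ZMod 2)) ∧ b 1 = 0) ∨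
    ((step 2 ({0} : Finset (Fin 4)) 0 b (⟨(∏ l, X l ^ (![3, (n + 1), g2, g3] : Fin 4 → ℕ) l * (1 + X l) ^ (![1, 0, e2, e3] : Fin 4 → ℕ) l : MvPolynomial (Fin 4) (ZMod 2)), r, exc⟩ : State (ZMod 2))).F =
        ((∏ l, X l ^ (![1, 0, (if b 2 = 0 then g2 else e2), (if b 3 = 0 then g3 else e3)] : Fin 4 → ℕ) l * (1 + X l) ^ (![0, (n + 1), (if b 2 = 0 then e2 else g2), (if b 3 = 0 then e3 else g3)] : Fin 4 → ℕ) l : MvPolynomial (Fin 4) (ZMod 2)) + (∏ l, X l ^ (![2, 1, (if b 2 = 0 then g2 else e2), (if b 3 = 0 then g3 else e3)] : Fin 4 → ℕ) l * (1 + X l) ^ (![0, n, (if b 2 = 0 then e2 else g2), (if b 3 = 0 then e3 else g3)] : Fin 4 → ℕ) l : MvPolynomial (Fin 4) (ZMod 2))) ∧ b 1 = 1) := by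
  have hP : ∀ u : ℕ, u % 2 = 0 → ∀ v : ℕ, v % 2 = 0 → ∀ z : ZMod 2, (if z = 0 then u else v) % 2 = 0 := by
    intro u hu v hv z; split_ifs <;> assumption
  have hp' := hP _ hg2 _ he2 (b 2); have hq' := hP _ hg3 _ he3 (b 3); have hr' := hP _ he2 _ hg2 (b 2); have hs' := hP _ he3 _ hg3 (b 3)
  change deletePthPowers 2 (PointBlowup.translate b (chartTransform 2 {0} 0 (∏ l, X l ^ (![3, (n + 1), g2, g3] : Fin 4 → ℕ) l * (1 + X l) ^ (![1, 0, e2, e3] : Fin 4 → ℕ) l : MvPolynomial (Fin 4) (ZMod 2)))) = _ ∧ _ ∨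
    deletePthPowers 2 (PointBlowup.translate b (chartTransform 2 {0} 0 (∏ l, X l ^ (![3, (n + 1), g2, g3] : Fin 4 → ℕ) l * (1 + X l) ^ (![1, 0, e2, e3] : Fin 4 → ℕ) l : MvPolynomial (Fin 4) (ZMod 2)))) = _ ∧ _
  rw [translate_chartTransform_singleton_prod (![3, (n + 1), g2, g3] : Fin 4 → ℕ) (![1, 0, e2, e3] : Fin 4 → ℕ) (i := 0) (by simp) b]
  rcases (by decide : ∀ z : ZMod 2, z = 0 ∨ z = 1) (b 1) with h1 | h1
  · left
    refine ⟨?_, h1⟩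
    rw [show (∏ l, X l ^ (if b l = 0 then Function.update (![3, (n + 1), g2, g3] : Fin 4 → ℕ) 0 ((![3, (n + 1), g2, g3] : Fin 4 → ℕ) 0 - 2) l else (![1, 0, e2, e3] : Fin 4 → ℕ) l) *
        (1 + X l) ^ (if b l = 0 then (![1, 0, e2, e3] : Fin 4 → ℕ) l else Function.update (![3, (n + 1), g2, g3] : Fin 4 → ℕ) 0 ((![3, (n + 1), g2, g3] : Fin 4 → ℕ) 0 - 2) l) : MvPolynomial (Fin 4) (ZMod 2)) =
        (∏ l, X l ^ (![1, (n + 1), (if b 2 = 0 then g2 else e2), (if b 3 = 0 then g3 else e3)] : Fin 4 → ℕ) l * (1 + X l) ^ (![1, 0, (if b 2 = 0 then e2 else g2), (if b 3 = 0 then e3 else g3)] : Fin 4 → ℕ) l : MvPolynomial (Fin 4) (ZMod 2)) from Finset.prod_congr rfl fun l _ => by fin_cases l <;> simp [h1, hb],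
      deletePthPowers_prod_of_purelyOdd (![1, (n + 1), (if b 2 = 0 then g2 else e2), (if b 3 = 0 then g3 else e3)] : Fin 4 → ℕ) (![1, 0, (if b 2 = 0 then e2 else g2), (if b 3 = 0 then e3 else g3)] : Fin 4 → ℕ) (l := 1) (by simp; omega) (by simp)]
  · right
    refine ⟨?_, h1⟩
    rw [show (∏ l, X l ^ (if b l = 0 then Function.update (![3, (n + 1), g2, g3] : Fin 4 → ℕ) 0 ((![3, (n + 1), g2, g3] : Fin 4 → ℕ) 0 - 2) l else (![1, 0, e2, e3] : Fin 4 → ℕ) l) *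
        (1 + X l) ^ (if b l = 0 then (![1, 0, e2, e3] : Fin 4 → ℕ) l else Function.update (![3, (n + 1), g2, g3] : Fin 4 → ℕ) 0 ((![3, (n + 1), g2, g3] : Fin 4 → ℕ) 0 - 2) l) : MvPolynomial (Fin 4) (ZMod 2)) =
        (∏ l, X l ^ (![1, 0, (if b 2 = 0 then g2 else e2), (if b 3 = 0 then g3 else e3)] : Fin 4 → ℕ) l * (1 + X l) ^ (![1, (n + 1), (if b 2 = 0 then e2 else g2), (if b 3 = 0 then e3 else g3)] : Fin 4 → ℕ) l : MvPolynomial (Fin 4) (ZMod 2)) from Finset.prod_congr rfl fun l _ => by fin_cases l <;> simp [h1, hb],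
      split_B1, deletePthPowers_add,
      deletePthPowers_prod_of_purelyOdd (![1, 0, (if b 2 = 0 then g2 else e2), (if b 3 = 0 then g3 else e3)] : Fin 4 → ℕ) (![0, (n + 1), (if b 2 = 0 then e2 else g2), (if b 3 = 0 then e3 else g3)] : Fin 4 → ℕ) (l := 0) (by simp) (by simp),
      clean_B_1 _ _ _ _ _ hn hp' hq' hr' hs']

end PureLeafNF

end Summit.ResolutionOfSingularities.ResolutionOfSingularities.Theorems.PIDim4

end
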